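import Literature.Barriers.CriticalPhenomena.PlaquetteWalkHoleRootSealedPocket
import HarnessLib

/-!
# Barrier catalogue (SAWScalingLimit): POCKET CHAINS — a corridor of cells ending in a dead end is never entered; a far door opening
into such a corridor kills both routes and the vertex functional

Leaf of `PlaquetteWalkHoleRootSealedPocket` (★ `ΩG.nth_ne_side_of_deadEnd_uncrossed`: a cell whose other sides are dead or uncrossed has
its last side uncrossed) and, through it, of `PlaquetteWalkHoleRootSealedDoors` (`ΩG.WE_eq_excursionWinding_of_farW_side_uncrossed`).
Setting: root plaquette `w` rooted at `W`, hole absent, far cell `farW w`; `ω` a class-`B2a` walk at the far cell.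

A POCKET CHAIN is a finite sequence of cells `g 0, …, g k` (none the root plaquette or the far cell) with an ENTRANCE side `s i` on
each, such that every side of `g i` other than its entrance and (for `i < k`) one LINK side `t i` is dead, the link side of `g i` being
the entrance side of `g (i + 1)` (`(g i).side (t i) = (g (i+1)).side (s (i+1))`), and the last cell `g k` having no link (a dead end).
Peeling from the dead end (`PlaquetteWalkHoleRootSealedPocket` §1, by induction on the distance to the end):

* §1 ★★★★ `ΩG.nth_ne_entrance_of_pocketChain` — the entrance `(g 0).side (s 0)` of a pocket chain is never a mid-edge of `ω`; every
  entrance `(g i).side (s i)` likewise (`…_at`).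
* §2 ★★★★ `ΩG.WE_eq_excursionWinding_of_farDoor_pocketChain` — if a far door (`(farW w).side z`, `z ≠ E`) is the entrance of a pocket
  chain, no class-`B2a` walk at the far cell is wound (both routes); ★★★ `vertexFunctional_printed_eq_zero_of_farDoor_pocketChain` —
  `V ≡ 0` on `[π/3, 2π/3]`. The dead-end doors (`k = 0`, `PlaquetteWalkHoleRootSealedDoors`) and the two-cell pocket (`k = 1`,
  `PlaquetteWalkHoleRootSealedPocket`) are the first two instances; this is the door-pocket rule (R1c) of the venture lane's predictor v4
  for corridors of any length, typed once (FINDING-YB-KILL-FORCED-ZEROS §28 add. 9).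

Not in print; venture lane «pcv-sawmu», seat b-step0 gen 30.

References: A. Glazman, Electron. Commun. Probab. 20 (2015) no. 86, Lemma 3.1, proof pp. 6–7 (the classes of walks through a rhombus)
[Glazman2015WeightedSAW]; A. Glazman, I. Manolescu, arXiv:1708.00395v3, §1 (Fig. 1: an arc joins two sides of its rhombus), §2.1,
Lemma 2.1 [GlazmanManolescu2019].
-/

noncomputable section

open Set Function Complex

namespace Literature.Probability.RandomPlanarGeometry.SAW.YangBaxter

open Real

namespace ΩG

variable {D : Set Face} {w : Face} {ω : ΩG D (w.side .W) (farW w)}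

/-! ## §1 Peeling a pocket chain from its dead end -/

/-- ★★★★ **EVERY ENTRANCE OF A POCKET CHAIN IS UNCROSSED.** Cells `g 0, …, g k` other than `w` and the far cell, entrance sides `s i`, link
sides `t i` (`i < k`) with `(g i).side (t i) = (g (i+1)).side (s (i+1))`, every other side dead; then for every `i ≤ k` the entrance
`(g i).side (s i)` is never a mid-edge of the class-`B2a` walk `ω` (indices `1 ≤ j ≤ length`). Induction on `k − i` from the dead end `g k`.
[cite: Glazman2015WeightedSAW, Lemma 3.1 (proof, pp. 6–7: the classes of walks through a rhombus)]
[cite: GlazmanManolescu2019, §1, Fig. 1 (an arc joins two sides of its rhombus)] -/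
theorem nth_ne_entrance_of_pocketChain_at (hh : holeFaceW w ∉ D) (hr : RootedFace D (w.side .W) (farW w)) (h : ω.IsB2a)
    {k : ℕ} {g : ℕ → Face} {s t : ℕ → Side}
    (hgw : ∀ i, i ≤ k → g i ≠ w) (hgf : ∀ i, i ≤ k → g i ≠ farW w)
    (hlink : ∀ i, i < k → (g i).side (t i) = (g (i + 1)).side (s (i + 1)))
    (hdead : ∀ i, i ≤ k → ∀ u : Side, u ≠ s i → (i < k → u ≠ t i) →
      ((g i).side u).faces.1 ∉ D ∨ ((g i).side u).faces.2 ∉ D) :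
    ∀ i, i ≤ k → ∀ j, 1 ≤ j → j ≤ ω.2.arcs.length → ω.2.nth j ≠ (g i).side (s i) := by
  -- induction on the distance `d = k - i` to the dead end
  suffices H : ∀ d i, i + d = k → ∀ j, 1 ≤ j → j ≤ ω.2.arcs.length → ω.2.nth j ≠ (g i).side (s i) by
    intro i hi
    exact H (k - i) i (by omega)
  intro d
  induction d with
  | zero =>
    intro i hik
    refine nth_ne_side_of_deadEnd_uncrossed hh hr h (hgw i (by omega)) (hgf i (by omega)) fun u hu => ?_
    exact Or.inl (hdead i (by omega) u hu (fun hlt => absurd hik (by omega)))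
  | succ d ih =>
    intro i hik
    have hnext := ih (i + 1) (by omega)
    refine nth_ne_side_of_deadEnd_uncrossed hh hr h (hgw i (by omega)) (hgf i (by omega)) fun u hu => ?_
    by_cases hut : u = t i
    · right
      rw [hut, hlink i (by omega)]
      exact hnext
    · exact Or.inl (hdead i (by omega) u hu (fun _ => hut))

/-- ★★★★ **THE ENTRANCE OF A POCKET CHAIN IS UNCROSSED** (the case `i = 0` of `…_at`).
[cite: Glazman2015WeightedSAW, Lemma 3.1 (proof, pp. 6–7)] [cite: GlazmanManolescu2019, §1, Fig. 1] -/
theorem nth_ne_entrance_of_pocketChain (hh : holeFaceW w ∉ D) (hr : RootedFace D (w.side .W) (farW w)) (h : ω.IsB2a)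
    {k : ℕ} {g : ℕ → Face} {s t : ℕ → Side}
    (hgw : ∀ i, i ≤ k → g i ≠ w) (hgf : ∀ i, i ≤ k → g i ≠ farW w)
    (hlink : ∀ i, i < k → (g i).side (t i) = (g (i + 1)).side (s (i + 1)))
    (hdead : ∀ i, i ≤ k → ∀ u : Side, u ≠ s i → (i < k → u ≠ t i) →
      ((g i).side u).faces.1 ∉ D ∨ ((g i).side u).faces.2 ∉ D) :
    ∀ j, 1 ≤ j → j ≤ ω.2.arcs.length → ω.2.nth j ≠ (g 0).side (s 0) :=
  nth_ne_entrance_of_pocketChain_at hh hr h hgw hgf hlink hdead 0 (Nat.zero_le _)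

/-! ## §2 A far door opening into a pocket chain -/

/-- ★★★★ **A FAR DOOR OPENING INTO A POCKET CHAIN KILLS BOTH ROUTES.** If the side `z ≠ E` of the far cell is the entrance of a pocket chain
(`(g 0).side (s 0) = (farW w).side z`), no class-`B2a` walk at the far cell is wound — in any domain, whatever the length of the chain.
[cite: Glazman2015WeightedSAW, Lemma 3.1 (proof, pp. 6–7)] [cite: GlazmanManolescu2019, §1 (Fig. 1), Lemma 2.1] -/
theorem WE_eq_excursionWinding_of_farDoor_pocketChain (hh : holeFaceW w ∉ D)
    {k : ℕ} {g : ℕ → Face} {s t : ℕ → Side} {z : Side} (hz : z ≠ .E) (h0 : (g 0).side (s 0) = (farW w).side z)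
    (hgw : ∀ i, i ≤ k → g i ≠ w) (hgf : ∀ i, i ≤ k → g i ≠ farW w)
    (hlink : ∀ i, i < k → (g i).side (t i) = (g (i + 1)).side (s (i + 1)))
    (hdead : ∀ i, i ≤ k → ∀ u : Side, u ≠ s i → (i < k → u ≠ t i) →
      ((g i).side u).faces.1 ∉ D ∨ ((g i).side u).faces.2 ∉ D)
    (ω : ΩG D (w.side .W) (farW w)) (hr : RootedFace D (w.side .W) (farW w)) (h : ω.IsB2a) (θ : ℝ) :
    ω.WE (fun _ => θ) = excursionWinding θ ω.2.firstSideG (ω.z1 hr h) ω.1 := by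
  refine WE_eq_excursionWinding_of_farW_side_uncrossed hh ω hr h hz (fun j hj1 hj2 => ?_) θ
  rw [← h0]
  exact nth_ne_entrance_of_pocketChain hh hr h hgw hgf hlink hdead j hj1 hj2

end ΩG

end Literature.Probability.RandomPlanarGeometry.SAW.YangBaxter

namespace Literature.Barriers.CriticalPhenomena.PlaquetteWalk

open Literature.Probability.RandomPlanarGeometry.SAW.YangBaxter
open Real Complex

/-! ## §2′ The vertex functional -/

section ChainVF

variable {Dl : List Face} {w : Face}

/-- ★★★ **A FAR DOOR OPENING INTO A POCKET CHAIN ⇒ `V ≡ 0`** (far cell present, hole absent; any further defects, any domain).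
[cite: GlazmanManolescu2019, Lemma 2.1 (statement, "in the form given in [Gl]"), §1 eq. (1)] [cite: Glazman2015WeightedSAW, Lemma 3.1 (proof, pp. 6–7)] -/
theorem vertexFunctional_printed_eq_zero_of_farDoor_pocketChain {θ : ℝ} (hθ : θ ∈ Set.Icc (π / 3) (2 * π / 3))
    (hf : farW w ∈ Dl) (hh : holeFaceW w ∉ dom Dl)
    {k : ℕ} {g : ℕ → Face} {s t : ℕ → Side} {z : Side} (hz : z ≠ .E) (h0 : (g 0).side (s 0) = (farW w).side z)
    (hgw : ∀ i, i ≤ k → g i ≠ w) (hgf : ∀ i, i ≤ k → g i ≠ farW w)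
    (hlink : ∀ i, i < k → (g i).side (t i) = (g (i + 1)).side (s (i + 1)))
    (hdead : ∀ i, i ≤ k → ∀ u : Side, u ≠ s i → (i < k → u ≠ t i) →
      ((g i).side u).faces.1 ∉ dom Dl ∨ ((g i).side u).faces.2 ∉ dom Dl) :
    vertexFunctional (printedWeights θ) tFiveEighths (ybCoeff θ) Dl (w.side .W) (farW w) = 0 :=
  vertexFunctional_printed_eq_zero_of_both_unwound hθ hf hh fun hr ω h =>
    ΩG.WE_eq_excursionWinding_of_farDoor_pocketChain hh hz h0 hgw hgf hlink hdead ω hr h θ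

end ChainVF

end Literature.Barriers.CriticalPhenomena.PlaquetteWalk
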